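import Summits.NavierStokesRegularity.NavierStokesRegularity.Theorems.TautLoopKelvinTautCompressionIntegrableSummitEquivalence
import Summits.NavierStokesRegularity.NavierStokesRegularity.Theorems.TautLoopKelvinCirculationFloor
import HarnessLib

/-!
# `TautLoopKelvin.TautCompressionIntegrable` (stmt-NavierStokesRegularity-15248) is summit-equivalent
  modulo `TautLoopLaw` ALONE

Sharpening of `TautLoopKelvinTautCompressionIntegrableSummitEquivalence.lean` (line lead c1, p161804) now
that the route's entry ticket `TautLoopKelvin.CirculationFloor` (stmt-NavierStokesRegularity-1538) is PROVED in
the tree (`Theorems.circulationFloor_proof`, `Theorems/TautLoopKelvinCirculationFloor.lean`): the hypothesis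
`hFloor` of the c1 certificate is discharged, so the crux K1 is equivalent to the no-blow-up item
`TypeILiouville.TypeIliouvilleThesis` (stmt-0054) and to the summit `NavierStokesRegularity` GIVEN ONLY the
route's remaining open crux `TautLoopKelvin.TautLoopLaw` (stmt-15249).

Consequence recorded for the crux chain of stmt-15248 (line lead c2, `Cruxes/TautCompressionIntegrable/PICKED.md`):
once `TautLoopLaw` lands, any proof of K1 is a proof of Clay (A) and any line for K1 must contain a stub proving no
blow-up for the whole hypothesis class; the item belongs parked on stmt-0054. No statement of any route is
asserted here; every theorem is an implication between named items and landed theorems.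
-/

noncomputable section

namespace Summit.NavierStokesRegularity.NavierStokesRegularity.Theorems.TautCompressionIntegrable.SummitEquivalence

open Summit.NavierStokesRegularity.NavierStokesRegularity

set_option linter.dupNamespace false

/-- **K1 and `TautLoopLaw` give stmt-0054** (no blow-up in the class): the c1 certificate
`typeILiouvilleThesis_of_tautCompressionIntegrable` with its `CirculationFloor` hypothesis discharged by the
landed `Theorems.circulationFloor_proof`. [folklore] -/
theorem typeILiouvilleThesis_of_tautCompressionIntegrable_of_tautLoopLaw
    (hK1 : Theses.TautLoopKelvin.TautCompressionIntegrable) (hLaw : Theses.TautLoopKelvin.TautLoopLaw) :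
    Theses.TypeILiouville.TypeIliouvilleThesis :=
  typeILiouvilleThesis_of_tautCompressionIntegrable hK1 hLaw Theorems.circulationFloor_proof

/-- **K1 and `TautLoopLaw` give the summit**: the route's deciding theorem `TautLoopKelvin.closes` with its
`CirculationFloor` hypothesis discharged by `Theorems.circulationFloor_proof`. [folklore] -/
theorem navierStokesRegularity_of_tautCompressionIntegrable_of_tautLoopLaw
    (hK1 : Theses.TautLoopKelvin.TautCompressionIntegrable) (hLaw : Theses.TautLoopKelvin.TautLoopLaw) :
    _root_.NavierStokesRegularity :=
  Theses.TautLoopKelvin.closes hK1 hLaw Theorems.circulationFloor_proof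

/-- **Given `TautLoopLaw` alone, K1 is equivalent to the no-blow-up item stmt-0054.** [folklore] -/
theorem tautCompressionIntegrable_iff_typeILiouvilleThesis_of_tautLoopLaw
    (hLaw : Theses.TautLoopKelvin.TautLoopLaw) :
    Theses.TautLoopKelvin.TautCompressionIntegrable ↔ Theses.TypeILiouville.TypeIliouvilleThesis :=
  tautCompressionIntegrable_iff_typeILiouvilleThesis hLaw Theorems.circulationFloor_proof

/-- **Given `TautLoopLaw` alone, K1 is equivalent to the summit `NavierStokesRegularity`.** [folklore] -/
theorem tautCompressionIntegrable_iff_navierStokesRegularity_of_tautLoopLaw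
    (hLaw : Theses.TautLoopKelvin.TautLoopLaw) :
    Theses.TautLoopKelvin.TautCompressionIntegrable ↔ _root_.NavierStokesRegularity :=
  tautCompressionIntegrable_iff_navierStokesRegularity hLaw Theorems.circulationFloor_proof

/-- **Registered tools stub `stub_summitEquivalenceLawOnlyTools` of the crux stmt-NavierStokesRegularity-15248**
(`ledger workitem stub-add`, line lead c2): the three Floor-free implications of this file as one conjunction —
K1 ∧ stmt-15249 ⇒ stmt-0054; stmt-15249 ⇒ (K1 ↔ summit); stmt-15249 ⇒ (K1 ↔ stmt-0054). [folklore] -/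
theorem stub_summitEquivalenceLawOnlyTools :
    (Summit.NavierStokesRegularity.NavierStokesRegularity.Theses.TautLoopKelvin.TautCompressionIntegrable →
      Summit.NavierStokesRegularity.NavierStokesRegularity.Theses.TautLoopKelvin.TautLoopLaw →
      Summit.NavierStokesRegularity.NavierStokesRegularity.Theses.TypeILiouville.TypeIliouvilleThesis) ∧
    (Summit.NavierStokesRegularity.NavierStokesRegularity.Theses.TautLoopKelvin.TautLoopLaw →
      (Summit.NavierStokesRegularity.NavierStokesRegularity.Theses.TautLoopKelvin.TautCompressionIntegrable ↔
        NavierStokesRegularity)) ∧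
    (Summit.NavierStokesRegularity.NavierStokesRegularity.Theses.TautLoopKelvin.TautLoopLaw →
      (Summit.NavierStokesRegularity.NavierStokesRegularity.Theses.TautLoopKelvin.TautCompressionIntegrable ↔
        Summit.NavierStokesRegularity.NavierStokesRegularity.Theses.TypeILiouville.TypeIliouvilleThesis)) :=
  ⟨typeILiouvilleThesis_of_tautCompressionIntegrable_of_tautLoopLaw,
    tautCompressionIntegrable_iff_navierStokesRegularity_of_tautLoopLaw,
    tautCompressionIntegrable_iff_typeILiouvilleThesis_of_tautLoopLaw⟩

end Summit.NavierStokesRegularity.NavierStokesRegularity.Theorems.TautCompressionIntegrable.SummitEquivalence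

end
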